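import Mathlib
import Literature.LinearAlgebra.Matrix.CauchyDeterminant

/-!
# Route BarrierLever — items `PrincipalMinorLayoutsNonsingular` (stmt-ValiantsHypothesis-19126) /
# `PartitionMinorsHitByVP` (stmt-ValiantsHypothesis-19717): principal minors of the SYMMETRIC CAUCHY
# MATRIX and the factorisation of its TNS layout matrix

Helper file (`--supports stmt-ValiantsHypothesis-19717`; cell valiant-natproofs, rung V4, 𝒟-side of
FSV18 Question 6; prover seat val-np-p3 gen 4). Definition-free, outside the theses cone (pure linear
algebra over `ℂ`). Closes NO item. Part 1 of 2: the companion file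
`BarrierLeverPrincipalMinorLayoutsSymmetricCauchy` turns the factorisation into the arrow
«symmetric Cauchy kernel conjecture ⇒ TNS ⇒ `PartitionMinorsHitByVP`».

**Content.** For `θ : Fin n → ℂ` with `θ_i + θ_j ≠ 0` and the symmetric Cauchy matrix
`C = ((θ_i + θ_j)⁻¹)`:
* `det_cauchy_principal` — `det C[S] = (∏_{i<j ∈ S} (θ_j - θ_i)²) / ∏_{i,j ∈ S} (θ_i + θ_j)` for
  every `S : Finset (Fin n)` (Cauchy's double alternant, tree
  `Literature.LinearAlgebra.Matrix.det_cauchyMatrix` with `y = -θ`, reindexed along the increasing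
  enumeration `Finset.orderEmbOfFin` of `S`); `det_cauchy_principal_ne_zero` (θ injective on `S`);
* `det_cauchy_principal_union` — the principal minors are PAIRWISE MULTIPLICATIVE:
  `det C[A ⊔ B] = det C[A] · det C[B] · ∏_{a ∈ A, b ∈ B} ((θ_a - θ_b)/(θ_a + θ_b))²`;
* `tns_entry_cauchy`, `tns_det_cauchy` — with `θ = (s, t)` on `Fin (h+h)` (`Fin.append`), the TNS
  layout matrix of `C` on the joined sets `u_i.map castAddEmb ∪ w_j.map natAddEmb` FACTORISES:
  `det (det C[u_i ⊔ w̄_j])_{i,j} = (∏_i det C[u_i-part]) · (∏_j det C[w_j-part]) ·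
  det (∏_{a ∈ u_i} ∏_{c ∈ w_j} ((s_a - t_c)/(s_a + t_c))²)_{i,j}`.

WHAT THIS IS NOT: identities only; nothing unconditional about TNS / item 19717, nothing on crux
stmt-14610 or `VP` vs `VNP`.

References: A.-L. Cauchy (1841); [Krattenthaler1999] §2.1 eq. (2.7) (double alternant).
-/

set_option linter.dupNamespace false

open Finset Matrix

namespace Summit.ValiantsHypothesis.ValiantsHypothesis.Theorems.BarrierLever.SymmetricCauchy

/-! ## 1. Principal minors of the symmetric Cauchy matrix `((θ_i + θ_j)⁻¹)` -/

/-- Double products over a union of disjoint finsets split into the two internal double products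
and the cross products (both orders). -/
theorem prod_prod_union {α M : Type*} [DecidableEq α] [CommMonoid M] (A B : Finset α)
    (hAB : Disjoint A B) (F : α → α → M) :
    ∏ i ∈ A ∪ B, ∏ j ∈ A ∪ B, F i j =
      (∏ i ∈ A, ∏ j ∈ A, F i j) * (∏ i ∈ B, ∏ j ∈ B, F i j) *
        ∏ a ∈ A, ∏ b ∈ B, (F a b * F b a) := by
  simp_rw [Finset.prod_union hAB, Finset.prod_mul_distrib]
  rw [Finset.prod_comm (s := B) (t := A) (f := fun b a => F b a)]
  ac_rfl

/-- **Principal minors of the symmetric Cauchy matrix.** For `θ : Fin n → ℂ` with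
`θ_i + θ_j ≠ 0` throughout and `S ⊆ Fin n`,
`det ((θ_i + θ_j)⁻¹)_{i,j ∈ S} = (∏_{i<j ∈ S} (θ_j - θ_i)²) / ∏_{i,j ∈ S} (θ_i + θ_j)`
(Cauchy's double alternant `Literature.LinearAlgebra.Matrix.det_cauchyMatrix` with `y = -θ`,
reindexed along the increasing enumeration of `S`). -/
theorem det_cauchy_principal {n : ℕ} (θ : Fin n → ℂ) (hθ : ∀ i j, θ i + θ j ≠ 0)
    (S : Finset (Fin n)) :
    ((Matrix.of fun i j : Fin n => (θ i + θ j)⁻¹).submatrix (Subtype.val : S → Fin n)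
        (Subtype.val : S → Fin n)).det =
      (∏ i ∈ S, ∏ j ∈ S, (if i < j then (θ j - θ i) ^ 2 else 1)) /
        ∏ i ∈ S, ∏ j ∈ S, (θ i + θ j) := by
  classical
  set k := S.card with hk
  set e : Fin k ≃o S := S.orderIsoOfFin rfl with he
  set emb : Fin k ↪o Fin n := S.orderEmbOfFin rfl with hemb
  have hemb_e : ∀ a : Fin k, ((e a : S) : Fin n) = emb a := fun a => Finset.coe_orderIsoOfFin_apply S rfl a
  -- Step 1: reindex the principal minor along the increasing enumeration of `S`
  have h1 : ((Matrix.of fun i j : Fin n => (θ i + θ j)⁻¹).submatrix (Subtype.val : S → Fin n)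
        (Subtype.val : S → Fin n)).det =
      ((Matrix.of fun i j : Fin n => (θ i + θ j)⁻¹).submatrix (fun a : Fin k => emb a)
        (fun a : Fin k => emb a)).det := by
    rw [← Matrix.det_submatrix_equiv_self e.toEquiv]
    congr 1
  rw [h1]
  -- Step 2: this is the Cauchy matrix of the sequences `x = θ ∘ emb`, `y = -x`
  set x : ℕ → ℂ := fun m => if hm : m < k then θ (emb ⟨m, hm⟩) else 0 with hx
  set y : ℕ → ℂ := fun m => -x m with hy
  have hxa : ∀ a : Fin k, x a = θ (emb a) := fun a => by simp [hx, a.isLt]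
  have hM : (Matrix.of fun i j : Fin n => (θ i + θ j)⁻¹).submatrix (fun a : Fin k => emb a)
      (fun a : Fin k => emb a) = Literature.LinearAlgebra.Matrix.cauchyMatrix x y k := by
    ext a b
    rw [Matrix.submatrix_apply, Matrix.of_apply, Literature.LinearAlgebra.Matrix.cauchyMatrix_apply,
      hy]
    dsimp only
    rw [hxa, hxa, sub_neg_eq_add]
  have hxy : ∀ i j : ℕ, i < k → j < k → x i ≠ y j := by
    intro i j hi hj
    rw [hy]
    dsimp only
    rw [show x i = θ (emb ⟨i, hi⟩) from hxa ⟨i, hi⟩, show x j = θ (emb ⟨j, hj⟩) from hxa ⟨j, hj⟩]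
    intro h0
    exact hθ (emb ⟨i, hi⟩) (emb ⟨j, hj⟩) (by rw [h0]; ring)
  rw [hM, Literature.LinearAlgebra.Matrix.det_cauchyMatrix x y k hxy]
  -- Step 3: rewrite the ordered products as products over `S`
  have hprodS : ∀ g : Fin n → ℂ, ∏ s ∈ S, g s = ∏ a : Fin k, g (emb a) := by
    intro g
    conv_lhs => rw [← Finset.map_orderEmbOfFin_univ S rfl]
    rw [Finset.prod_map]
    rfl
  congr 1
  · -- numerator
    simp_rw [hprodS]
    rw [Finset.prod_comm]
    rw [← Fin.prod_univ_eq_prod_range (fun j => ∏ i ∈ range j, ((x j - x i) * (y i - y j))) k]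
    refine Finset.prod_congr rfl fun b _ => ?_
    have hrange : range (b : ℕ) = (range k).filter (fun i : ℕ => i < (b : ℕ)) := by
      ext i
      simp only [Finset.mem_range, Finset.mem_filter]
      constructor
      · intro hi; exact ⟨lt_trans hi b.isLt, hi⟩
      · intro hi; exact hi.2
    rw [hrange, Finset.prod_filter, ← Fin.prod_univ_eq_prod_range (fun i => if i < (b : ℕ) then
      (x b - x i) * (y i - y b) else 1) k]
    refine Finset.prod_congr rfl fun a _ => ?_
    have hlt : (a : ℕ) < (b : ℕ) ↔ emb a < emb b := by
      rw [emb.lt_iff_lt]; exact Iff.rfl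
    by_cases hab : (a : ℕ) < (b : ℕ)
    · rw [if_pos hab, if_pos (hlt.1 hab), hy]
      dsimp only
      rw [hxa, hxa]; ring
    · rw [if_neg hab, if_neg (fun h' => hab (hlt.2 h'))]
  · -- denominator
    simp_rw [hprodS]
    rw [← Fin.prod_univ_eq_prod_range (fun i => ∏ j ∈ range k, (x i - y j)) k]
    refine Finset.prod_congr rfl fun a _ => ?_
    rw [← Fin.prod_univ_eq_prod_range (fun j => x a - y j) k]
    refine Finset.prod_congr rfl fun b _ => ?_
    rw [hy]
    dsimp only
    rw [hxa, hxa, sub_neg_eq_add]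

/-- Nonvanishing of the principal minors of the symmetric Cauchy matrix on a finset on which `θ`
is injective. -/
theorem det_cauchy_principal_ne_zero {n : ℕ} (θ : Fin n → ℂ) (hθ : ∀ i j, θ i + θ j ≠ 0)
    (S : Finset (Fin n)) (hinj : Set.InjOn θ S) :
    ((Matrix.of fun i j : Fin n => (θ i + θ j)⁻¹).submatrix (Subtype.val : S → Fin n)
        (Subtype.val : S → Fin n)).det ≠ 0 := by
  rw [det_cauchy_principal θ hθ S]
  refine div_ne_zero ?_ ?_
  · refine Finset.prod_ne_zero_iff.2 fun i hi => Finset.prod_ne_zero_iff.2 fun j hj => ?_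
    split_ifs with hij
    · exact pow_ne_zero _ (sub_ne_zero.2 fun h0 => (ne_of_lt hij) (hinj hi hj h0.symm))
    · exact one_ne_zero
  · exact Finset.prod_ne_zero_iff.2 fun i _ => Finset.prod_ne_zero_iff.2 fun j _ => hθ i j

/-- **Splitting a principal minor over a disjoint union.** For disjoint `A, B ⊆ Fin n`:
`det C[A ∪ B] = det C[A] · det C[B] · ∏_{a ∈ A, b ∈ B} ((θ_a - θ_b)/(θ_a + θ_b))²`
— the principal minors of the symmetric Cauchy matrix are PAIRWISE MULTIPLICATIVE. -/
theorem det_cauchy_principal_union {n : ℕ} (θ : Fin n → ℂ) (hθ : ∀ i j, θ i + θ j ≠ 0)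
    (A B : Finset (Fin n)) (hAB : Disjoint A B) :
    ((Matrix.of fun i j : Fin n => (θ i + θ j)⁻¹).submatrix (Subtype.val : ↥(A ∪ B) → Fin n)
        (Subtype.val : ↥(A ∪ B) → Fin n)).det =
      ((Matrix.of fun i j : Fin n => (θ i + θ j)⁻¹).submatrix (Subtype.val : A → Fin n)
          (Subtype.val : A → Fin n)).det *
        ((Matrix.of fun i j : Fin n => (θ i + θ j)⁻¹).submatrix (Subtype.val : B → Fin n)
          (Subtype.val : B → Fin n)).det *
        ∏ a ∈ A, ∏ b ∈ B, ((θ a - θ b) / (θ a + θ b)) ^ 2 := by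
  classical
  rw [det_cauchy_principal θ hθ (A ∪ B), det_cauchy_principal θ hθ A, det_cauchy_principal θ hθ B,
    prod_prod_union A B hAB, prod_prod_union A B hAB]
  have hX : ∏ a ∈ A, ∏ b ∈ B, ((if a < b then (θ b - θ a) ^ 2 else 1) *
      (if b < a then (θ a - θ b) ^ 2 else 1)) = ∏ a ∈ A, ∏ b ∈ B, (θ a - θ b) ^ 2 := by
    refine Finset.prod_congr rfl fun a ha => Finset.prod_congr rfl fun b hb => ?_
    have hab : a ≠ b := fun h0 => Finset.disjoint_left.1 hAB ha (h0 ▸ hb)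
    rcases lt_or_gt_of_ne hab with h0 | h0
    · rw [if_pos h0, if_neg (not_lt.2 h0.le)]; ring
    · rw [if_neg (not_lt.2 h0.le), if_pos h0]; ring
  have hY : ∏ a ∈ A, ∏ b ∈ B, ((θ a + θ b) * (θ b + θ a)) = ∏ a ∈ A, ∏ b ∈ B, (θ a + θ b) ^ 2 :=
    Finset.prod_congr rfl fun a _ => Finset.prod_congr rfl fun b _ => by ring
  rw [hX, hY]
  simp_rw [div_pow, Finset.prod_div_distrib]
  rw [div_mul_div_comm, div_mul_div_comm]

/-! ## 2. The TNS matrix of the symmetric Cauchy witness -/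

/-- The two halves `u.map castAddEmb` (x-indices) and `w.map natAddEmb` (y-indices) of the joined
index set are disjoint. -/
theorem disjoint_map_castAdd_natAdd (h : ℕ) (u w : Finset (Fin h)) :
    Disjoint (u.map (Fin.castAddEmb h)) (w.map (Fin.natAddEmb h)) := by
  rw [Finset.disjoint_left]
  intro x hxu hxw
  obtain ⟨a, -, rfl⟩ := Finset.mem_map.1 hxu
  obtain ⟨c, -, hc⟩ := Finset.mem_map.1 hxw
  have h1 := congrArg Fin.val hc
  simp only [Fin.castAddEmb_apply, Fin.natAddEmb_apply, Fin.val_castAdd, Fin.val_natAdd] at h1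
  have := a.isLt
  omega

/-- **Entries of the TNS matrix of the symmetric Cauchy witness.** With `θ = (s, t)` on
`Fin (h+h)` and `C = ((θ_i + θ_j)⁻¹)`, the principal minor of `C` on the joined set
`u.map castAddEmb ∪ w.map natAddEmb` is
`det C[u-part] · det C[w-part] · ∏_{a ∈ u} ∏_{c ∈ w} ((s_a - t_c)/(s_a + t_c))²`. -/
theorem tns_entry_cauchy (h : ℕ) (s t : Fin h → ℂ)
    (hθ : ∀ i j, Fin.append s t i + Fin.append s t j ≠ 0) (u w : Finset (Fin h)) :
    ((Matrix.of fun i j : Fin (h + h) => (Fin.append s t i + Fin.append s t j)⁻¹).submatrix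
        (Subtype.val : ↥(u.map (Fin.castAddEmb h) ∪ w.map (Fin.natAddEmb h)) → Fin (h + h))
        (Subtype.val : ↥(u.map (Fin.castAddEmb h) ∪ w.map (Fin.natAddEmb h)) → Fin (h + h))).det =
      ((Matrix.of fun i j : Fin (h + h) => (Fin.append s t i + Fin.append s t j)⁻¹).submatrix
          (Subtype.val : ↥(u.map (Fin.castAddEmb h)) → Fin (h + h))
          (Subtype.val : ↥(u.map (Fin.castAddEmb h)) → Fin (h + h))).det *
        ((Matrix.of fun i j : Fin (h + h) => (Fin.append s t i + Fin.append s t j)⁻¹).submatrix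
          (Subtype.val : ↥(w.map (Fin.natAddEmb h)) → Fin (h + h))
          (Subtype.val : ↥(w.map (Fin.natAddEmb h)) → Fin (h + h))).det *
        ∏ a ∈ u, ∏ c ∈ w, ((s a - t c) / (s a + t c)) ^ 2 := by
  rw [det_cauchy_principal_union (Fin.append s t) hθ _ _ (disjoint_map_castAdd_natAdd h u w),
    Finset.prod_map]
  congr 1
  refine Finset.prod_congr rfl fun a _ => ?_
  rw [Finset.prod_map]
  refine Finset.prod_congr rfl fun c _ => ?_
  simp only [Fin.castAddEmb_apply, Fin.natAddEmb_apply, Fin.append_left, Fin.append_right]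

/-- **The TNS layout determinant of the symmetric Cauchy witness FACTORISES**: for any families
`u, w : Fin r → Finset (Fin h)`,
`det (det C[u_i ⊔ w̄_j])_{i,j} = (∏_i det C[u_i-part]) · (∏_j det C[w_j-part]) ·
  det (∏_{a ∈ u_i} ∏_{c ∈ w_j} ((s_a - t_c)/(s_a + t_c))²)_{i,j}`. -/
theorem tns_det_cauchy (h r : ℕ) (s t : Fin h → ℂ)
    (hθ : ∀ i j, Fin.append s t i + Fin.append s t j ≠ 0) (u w : Fin r → Finset (Fin h)) :
    (Matrix.of fun i j : Fin r =>
      ((Matrix.of fun i j : Fin (h + h) => (Fin.append s t i + Fin.append s t j)⁻¹).submatrix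
        (Subtype.val : ↥((u i).map (Fin.castAddEmb h) ∪ (w j).map (Fin.natAddEmb h)) → Fin (h + h))
        (Subtype.val : ↥((u i).map (Fin.castAddEmb h) ∪ (w j).map (Fin.natAddEmb h)) →
          Fin (h + h))).det).det =
      (∏ i : Fin r, ((Matrix.of fun i j : Fin (h + h) =>
          (Fin.append s t i + Fin.append s t j)⁻¹).submatrix
          (Subtype.val : ↥((u i).map (Fin.castAddEmb h)) → Fin (h + h))
          (Subtype.val : ↥((u i).map (Fin.castAddEmb h)) → Fin (h + h))).det) *
      (∏ j : Fin r, ((Matrix.of fun i j : Fin (h + h) =>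
          (Fin.append s t i + Fin.append s t j)⁻¹).submatrix
          (Subtype.val : ↥((w j).map (Fin.natAddEmb h)) → Fin (h + h))
          (Subtype.val : ↥((w j).map (Fin.natAddEmb h)) → Fin (h + h))).det) *
      (Matrix.of fun i j : Fin r => ∏ a ∈ u i, ∏ c ∈ w j, ((s a - t c) / (s a + t c)) ^ 2).det := by
  have hmat : (Matrix.of fun i j : Fin r =>
      ((Matrix.of fun i j : Fin (h + h) => (Fin.append s t i + Fin.append s t j)⁻¹).submatrix
        (Subtype.val : ↥((u i).map (Fin.castAddEmb h) ∪ (w j).map (Fin.natAddEmb h)) → Fin (h + h))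
        (Subtype.val : ↥((u i).map (Fin.castAddEmb h) ∪ (w j).map (Fin.natAddEmb h)) →
          Fin (h + h))).det) =
      Matrix.of fun i j : Fin r =>
        ((Matrix.of fun i j : Fin (h + h) => (Fin.append s t i + Fin.append s t j)⁻¹).submatrix
          (Subtype.val : ↥((u i).map (Fin.castAddEmb h)) → Fin (h + h))
          (Subtype.val : ↥((u i).map (Fin.castAddEmb h)) → Fin (h + h))).det *
        (Matrix.of fun i j : Fin r =>
          ((Matrix.of fun i j : Fin (h + h) => (Fin.append s t i + Fin.append s t j)⁻¹).submatrix
            (Subtype.val : ↥((w j).map (Fin.natAddEmb h)) → Fin (h + h))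
            (Subtype.val : ↥((w j).map (Fin.natAddEmb h)) → Fin (h + h))).det *
          (Matrix.of fun i j : Fin r =>
            ∏ a ∈ u i, ∏ c ∈ w j, ((s a - t c) / (s a + t c)) ^ 2) i j) i j := by
    ext i j
    simp only [Matrix.of_apply]
    rw [tns_entry_cauchy h s t hθ (u i) (w j), mul_assoc]
  rw [hmat, Matrix.det_mul_column, Matrix.det_mul_row, mul_assoc]

end Summit.ValiantsHypothesis.ValiantsHypothesis.Theorems.BarrierLever.SymmetricCauchy
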